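import Literature.MathematicalPhysics.QuantumManyBody.PeriodicFeynmanKacTrialState
import Literature.MathematicalPhysics.QuantumManyBody.WeightedCorrector
import HarnessLib

/-!
# Response dictionary, part A: second-order calculus of the perturbation `(1 + sβ)F` on the cell

Support file for the registered stub `stub_responseDictionary` of line `healing-scale-kac-insertion`
(crux `BECInsertionCorrector.CorrectorClosure`, item stmt-AtomisticToContinuum-12058): elementary
real-analysis lemmas on the fundamental cell `[0,L)^{3N}` — integrability and bounds of bounded
measurable integrands, the `fderiv` product rule for `(1 + sβ)F`, and the resulting EXACT
second-order expansions in `s` of the kinetic integral `∫ |∇((1+sβ)F)|²` and of the weighted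
masses `∫ ((1+sβ)F)² w` (no integration by parts anywhere).
Supports (does not close) stmt-AtomisticToContinuum-12058, route `BECInsertionCorrector`.
-/

noncomputable section

open MeasureTheory Filter
open scoped ENNReal NNReal BigOperators Topology

namespace Summit.AtomisticToContinuum.BoseEinsteinCondensation.Theorems.CorrectorClosure.HealingScaleKacInsertion.ResponseDictionary

open Literature.MathematicalPhysics.QuantumManyBody.BoseGas

variable {N : ℕ}


/-! ### Bounded measurable integrands on the cell -/

/-- A bounded measurable real function is integrable on the (finite-volume) fundamental cell.
[folklore] -/
theorem integrableOn_cellN_of_abs_le {L : ℝ} {f : Config N → ℝ} (hf : Measurable f) {B : ℝ}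
    (hB : ∀ X, |f X| ≤ B) : IntegrableOn f (cellN N L) volume :=
  Measure.integrableOn_of_bounded (volume_cellN_ne_top N L) hf.aestronglyMeasurable
    (ae_of_all _ fun X => by rw [Real.norm_eq_abs]; exact hB X)

/-- `|∫_cell f| ≤ B · vol(cell)` when `|f| ≤ B` (no measurability needed). [folklore] -/
theorem abs_setIntegral_cellN_le {L : ℝ} {f : Config N → ℝ} {B : ℝ} (hB : ∀ X, |f X| ≤ B) :
    |∫ X in cellN N L, f X| ≤ B * (volume (cellN N L)).toReal := by
  -- adapted from `abs_setIntegral_cellN_sq_sub_sq_mul_le` (PeriodicFeynmanKacTrialState)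
  haveI : IsFiniteMeasure (volume.restrict (cellN N L) : Measure (Config N)) :=
    ⟨by rw [Measure.restrict_apply_univ]; exact (volume_cellN_ne_top N L).lt_top⟩
  rw [← Real.norm_eq_abs]
  calc ‖∫ X in cellN N L, f X‖ ≤ B * (volume.restrict (cellN N L)).real Set.univ :=
        norm_integral_le_of_norm_le_const (Eventually.of_forall fun X => by
          rw [Real.norm_eq_abs]; exact hB X)
    _ = B * (volume (cellN N L)).toReal := by
        rw [measureReal_def, Measure.restrict_apply_univ]

/-- Pointwise bounds multiply: `|f| ≤ A` and `|g| ≤ B` on configuration space give `|fg| ≤ AB`.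
[folklore] -/
theorem abs_mul_le_forall {f g : Config N → ℝ} {A B : ℝ} (hf : ∀ X, |f X| ≤ A) (hg : ∀ X, |g X| ≤ B)
    (X : Config N) : |f X * g X| ≤ A * B := by
  rw [abs_mul]
  exact mul_le_mul (hf X) (hg X) (abs_nonneg _) ((abs_nonneg _).trans (hf X))

/-- `|F| ≤ M` on configuration space gives `|F²| ≤ M²`. [folklore] -/
theorem abs_sq_le_forall {F : Config N → ℝ} {M : ℝ} (hF : ∀ X, |F X| ≤ M) (X : Config N) :
    |F X ^ 2| ≤ M ^ 2 := by
  rw [abs_pow]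
  exact pow_le_pow_left₀ (abs_nonneg _) (hF X) 2

/-- The carré du champ `|∇β|²` of a periodic `C¹` function is continuous, periodic, hence bounded.
[folklore] -/
theorem exists_gradDot_le_of_periodic {L : ℝ} (hL : 0 < L) {β : Config N → ℝ}
    (hβ : ContDiff ℝ 1 β)
    (hper : ∀ (X : Config N) (i : Fin N) (k : Fin 3),
      β (X + Pi.single i (EuclideanSpace.single k L)) = β X) :
    ∃ B : ℝ, 0 ≤ B ∧ ∀ X, |gradDot β β X| ≤ B := by
  refine exists_bound_of_continuous_periodic hL (continuous_gradDot hβ hβ) fun X i k => ?_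
  simp only [gradDot, pderiv, fderiv_periodic hper]

/-! ### The product rule for `(1 + sβ)F` and the pointwise expansions -/

/-- `∂_{ik}((1+sβ)F) = (1+sβ) ∂_{ik}F + s F ∂_{ik}β`. [folklore] -/
theorem pderiv_perturb {β F : Config N → ℝ} {X : Config N} (hβ : DifferentiableAt ℝ β X)
    (hF : DifferentiableAt ℝ F X) (s : ℝ) (i : Fin N) (k : Fin 3) :
    pderiv i k (fun Y => (1 + s * β Y) * F Y) X =
      (1 + s * β X) * pderiv i k F X + s * F X * pderiv i k β X := by
  have h1 : HasFDerivAt (fun Y => 1 + s * β Y) (s • fderiv ℝ β X) X :=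
    (hβ.hasFDerivAt.const_mul s).const_add 1
  have h2 := h1.fun_mul hF.hasFDerivAt
  unfold pderiv
  rw [h2.fderiv]
  simp only [add_apply, FunLike.coe_smul, Pi.smul_apply, smul_eq_mul]
  ring

/-- `∂_{ik}(β²) = 2β ∂_{ik}β`. [folklore] -/
theorem pderiv_sq {β : Config N → ℝ} {X : Config N} (hβ : DifferentiableAt ℝ β X) (i : Fin N)
    (k : Fin 3) : pderiv i k (fun Y => β Y ^ 2) X = 2 * β X * pderiv i k β X := by
  have h := hβ.hasFDerivAt.fun_mul hβ.hasFDerivAt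
  unfold pderiv
  rw [show (fun Y => β Y ^ 2) = fun Y => β Y * β Y from funext fun Y => sq (β Y), h.fderiv]
  simp only [add_apply, FunLike.coe_smul, Pi.smul_apply, smul_eq_mul]
  ring

/-- `Γ(β², F) = 2β Γ(β, F)`. [folklore] -/
theorem gradDot_sq_left {β : Config N → ℝ} (F : Config N → ℝ) {X : Config N}
    (hβ : DifferentiableAt ℝ β X) :
    gradDot (fun Y => β Y ^ 2) F X = 2 * β X * gradDot β F X := by
  simp only [gradDot, pderiv_sq hβ, Finset.mul_sum]
  refine Finset.sum_congr rfl fun i _ => Finset.sum_congr rfl fun k _ => ?_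
  ring

/-- **Pointwise second-order expansion of `|∇((1+sβ)F)|²`**:
`Γ(f_s,f_s) = Γ(F,F) + 2s(βΓ(F,F) + FΓ(β,F)) + s²(β²Γ(F,F) + 2βFΓ(β,F) + F²Γ(β,β))`. [folklore] -/
theorem gradDot_perturb {β F : Config N → ℝ} {X : Config N} (hβ : DifferentiableAt ℝ β X)
    (hF : DifferentiableAt ℝ F X) (s : ℝ) :
    gradDot (fun Y => (1 + s * β Y) * F Y) (fun Y => (1 + s * β Y) * F Y) X =
      gradDot F F X + 2 * s * (β X * gradDot F F X + F X * gradDot β F X) +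
        s ^ 2 * (β X ^ 2 * gradDot F F X + 2 * (β X * F X * gradDot β F X) +
          F X ^ 2 * gradDot β β X) := by
  have key : ∀ (i : Fin N) (k : Fin 3),
      pderiv i k (fun Y => (1 + s * β Y) * F Y) X * pderiv i k (fun Y => (1 + s * β Y) * F Y) X =
        (1 + s * β X) ^ 2 * (pderiv i k F X * pderiv i k F X) +
          (2 * s * (1 + s * β X) * F X) * (pderiv i k β X * pderiv i k F X) +
          (s ^ 2 * F X ^ 2) * (pderiv i k β X * pderiv i k β X) := by
    intro i k; rw [pderiv_perturb hβ hF]; ring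
  calc gradDot (fun Y => (1 + s * β Y) * F Y) (fun Y => (1 + s * β Y) * F Y) X
      = (1 + s * β X) ^ 2 * gradDot F F X + (2 * s * (1 + s * β X) * F X) * gradDot β F X +
          (s ^ 2 * F X ^ 2) * gradDot β β X := by
        simp only [gradDot, key, Finset.sum_add_distrib, Finset.mul_sum]
    _ = _ := by ring

/-- `((1+sβ)F)² w = F²w + 2s F²(βw) + s² F²(β²w)`. [folklore] -/
theorem sq_perturb_mul (β F w : Config N → ℝ) (s : ℝ) (X : Config N) :
    ((1 + s * β X) * F X) ^ 2 * w X =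
      F X ^ 2 * w X + 2 * s * (F X ^ 2 * (β X * w X)) + s ^ 2 * (F X ^ 2 * (β X ^ 2 * w X)) := by
  ring

/-- **AM–GM for the cross term**: `2βF Γ(β,F) ≤ Γ(F,F) + β²F² Γ(β,β)`. [folklore] -/
theorem two_mul_cross_le (β F : Config N → ℝ) (X : Config N) :
    2 * (β X * F X * gradDot β F X) ≤ gradDot F F X + β X ^ 2 * F X ^ 2 * gradDot β β X := by
  simp only [gradDot, Finset.mul_sum, ← Finset.sum_add_distrib]
  refine Finset.sum_le_sum fun i _ => Finset.sum_le_sum fun k _ => ?_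
  nlinarith [sq_nonneg (β X * F X * pderiv i k β X - pderiv i k F X)]

/-- **Pointwise bound on the second-order kinetic coefficient**:
`β²Γ(F,F) + 2βFΓ(β,F) + F²Γ(β,β) ≤ (B² + 1)(Γ(F,F) + F²Γ(β,β))` when `|β| ≤ B`. [folklore] -/
theorem cKin_integrand_le {β F : Config N → ℝ} {B : ℝ} (hB : ∀ X, |β X| ≤ B) (X : Config N) :
    β X ^ 2 * gradDot F F X + 2 * (β X * F X * gradDot β F X) + F X ^ 2 * gradDot β β X ≤
      (B ^ 2 + 1) * (gradDot F F X + F X ^ 2 * gradDot β β X) := by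
  have h1 := two_mul_cross_le β F X
  have hβ2 : β X ^ 2 ≤ B ^ 2 := by
    have := hB X; rw [← sq_abs]; exact pow_le_pow_left₀ (abs_nonneg _) this 2
  have hA := gradDot_self_nonneg F X
  have hC : 0 ≤ F X ^ 2 * gradDot β β X := mul_nonneg (sq_nonneg _) (gradDot_self_nonneg β X)
  nlinarith [mul_le_mul_of_nonneg_right hβ2 hA, mul_le_mul_of_nonneg_right hβ2 hC]

/-! ### Integrated expansions -/

section Integrated

variable {L : ℝ} {β F : Config N → ℝ}

/-- **Second-order expansion of the kinetic integral**:
`∫|∇((1+sβ)F)|² = ∫|∇F|² + 2s∫(βΓ(F,F) + FΓ(β,F)) + s²∫(β²Γ(F,F) + 2βFΓ(β,F) + F²Γ(β,β))`. [folklore] -/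
theorem integral_gradDot_perturb (hβ : ContDiff ℝ 1 β) (hF : ContDiff ℝ 1 F) (s : ℝ) :
    ∫ X in cellN N L, gradDot (fun Y => (1 + s * β Y) * F Y) (fun Y => (1 + s * β Y) * F Y) X =
      (∫ X in cellN N L, gradDot F F X) +
        2 * s * (∫ X in cellN N L, (β X * gradDot F F X + F X * gradDot β F X)) +
        s ^ 2 * ∫ X in cellN N L,
          (β X ^ 2 * gradDot F F X + 2 * (β X * F X * gradDot β F X) + F X ^ 2 * gradDot β β X) := by
  have hβd := hβ.differentiable one_ne_zero
  have hFd := hF.differentiable one_ne_zero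
  have hβc := hβ.continuous
  have hFc := hF.continuous
  have hFF := continuous_gradDot hF hF
  have hβF := continuous_gradDot hβ hF
  have hββ := continuous_gradDot hβ hβ
  have i0 : IntegrableOn (fun X => gradDot F F X) (cellN N L) := integrableOn_cellN hFF L
  have i1 : IntegrableOn (fun X => β X * gradDot F F X + F X * gradDot β F X) (cellN N L) :=
    integrableOn_cellN ((hβc.mul hFF).add (hFc.mul hβF)) L
  have i2 : IntegrableOn (fun X => β X ^ 2 * gradDot F F X + 2 * (β X * F X * gradDot β F X) +
      F X ^ 2 * gradDot β β X) (cellN N L) :=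
    integrableOn_cellN ((((hβc.pow 2).mul hFF).add (continuous_const.mul
      (((hβc.mul hFc).mul hβF)))).add ((hFc.pow 2).mul hββ)) L
  have hpt : ∀ X, gradDot (fun Y => (1 + s * β Y) * F Y) (fun Y => (1 + s * β Y) * F Y) X =
      gradDot F F X + 2 * s * (β X * gradDot F F X + F X * gradDot β F X) +
        s ^ 2 * (β X ^ 2 * gradDot F F X + 2 * (β X * F X * gradDot β F X) +
          F X ^ 2 * gradDot β β X) := fun X => gradDot_perturb (hβd X) (hFd X) s
  simp_rw [hpt]
  have hA : IntegrableOn (fun X => gradDot F F X +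
      2 * s * (β X * gradDot F F X + F X * gradDot β F X)) (cellN N L) := i0.add (i1.const_mul _)
  have hB : IntegrableOn (fun X => 2 * s * (β X * gradDot F F X + F X * gradDot β F X)) (cellN N L) :=
    i1.const_mul _
  have hC : IntegrableOn (fun X => s ^ 2 * (β X ^ 2 * gradDot F F X + 2 * (β X * F X * gradDot β F X) +
      F X ^ 2 * gradDot β β X)) (cellN N L) := i2.const_mul _
  rw [integral_add hA hC, integral_add i0 hB, integral_const_mul, integral_const_mul]

/-- **Second-order expansion of a weighted mass**: `∫((1+sβ)F)²w = ∫F²w + 2s∫F²βw + s²∫F²β²w`,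
given integrability of the three pieces. [folklore] -/
theorem integral_sq_perturb_mul {w : Config N → ℝ} (s : ℝ)
    (h0 : IntegrableOn (fun X => F X ^ 2 * w X) (cellN N L))
    (h1 : IntegrableOn (fun X => F X ^ 2 * (β X * w X)) (cellN N L))
    (h2 : IntegrableOn (fun X => F X ^ 2 * (β X ^ 2 * w X)) (cellN N L)) :
    ∫ X in cellN N L, ((1 + s * β X) * F X) ^ 2 * w X =
      (∫ X in cellN N L, F X ^ 2 * w X) + 2 * s * (∫ X in cellN N L, F X ^ 2 * (β X * w X)) +
        s ^ 2 * ∫ X in cellN N L, F X ^ 2 * (β X ^ 2 * w X) := by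
  simp_rw [sq_perturb_mul β F w s]
  have hA : IntegrableOn (fun X => F X ^ 2 * w X + 2 * s * (F X ^ 2 * (β X * w X))) (cellN N L) :=
    h0.add (h1.const_mul _)
  have hB : IntegrableOn (fun X => 2 * s * (F X ^ 2 * (β X * w X))) (cellN N L) := h1.const_mul _
  have hC : IntegrableOn (fun X => s ^ 2 * (F X ^ 2 * (β X ^ 2 * w X))) (cellN N L) :=
    h2.const_mul _
  rw [integral_add hA hC, integral_add h0 hB, integral_const_mul, integral_const_mul]

/-- The unweighted case: `∫((1+sβ)F)² = ∫F² + 2s∫F²β + s²∫F²β²` for continuous data. [folklore] -/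
theorem integral_sq_perturb (hβ : Continuous β) (hF : Continuous F) (s : ℝ) :
    ∫ X in cellN N L, ((1 + s * β X) * F X) ^ 2 =
      (∫ X in cellN N L, F X ^ 2) + 2 * s * (∫ X in cellN N L, F X ^ 2 * β X) +
        s ^ 2 * ∫ X in cellN N L, F X ^ 2 * β X ^ 2 := by
  have h := integral_sq_perturb_mul (L := L) (β := β) (F := F) (w := fun _ => (1 : ℝ)) s
    (integrableOn_cellN ((hF.pow 2).mul continuous_const) L)
    (integrableOn_cellN ((hF.pow 2).mul (hβ.mul continuous_const)) L)
    (integrableOn_cellN ((hF.pow 2).mul ((hβ.pow 2).mul continuous_const)) L)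
  simpa only [mul_one] using h

/-- **The second-order kinetic coefficient of `β` is the first-order one of `β²` plus `∫F²|∇β|²`**
(`Γ(β²,F) = 2βΓ(β,F)`; this is how the ground-state representation appears in the limit). [folklore] -/
theorem integral_cKin_eq (hβ : ContDiff ℝ 1 β) (hF : ContDiff ℝ 1 F) :
    ∫ X in cellN N L,
        (β X ^ 2 * gradDot F F X + 2 * (β X * F X * gradDot β F X) + F X ^ 2 * gradDot β β X) =
      (∫ X in cellN N L, ((fun Y => β Y ^ 2) X * gradDot F F X +
          F X * gradDot (fun Y => β Y ^ 2) F X)) +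
        ∫ X in cellN N L, F X ^ 2 * gradDot β β X := by
  have hβd := hβ.differentiable one_ne_zero
  have hβ2 : ContDiff ℝ 1 fun Y => β Y ^ 2 := hβ.pow 2
  have hβc := hβ.continuous
  have hFc := hF.continuous
  have i1 : IntegrableOn (fun X => (fun Y => β Y ^ 2) X * gradDot F F X +
      F X * gradDot (fun Y => β Y ^ 2) F X) (cellN N L) :=
    integrableOn_cellN (((hβc.pow 2).mul (continuous_gradDot hF hF)).add
      (hFc.mul (continuous_gradDot hβ2 hF))) L
  have i2 : IntegrableOn (fun X => F X ^ 2 * gradDot β β X) (cellN N L) :=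
    integrableOn_cellN ((hFc.pow 2).mul (continuous_gradDot hβ hβ)) L
  rw [← integral_add i1 i2]
  refine integral_congr_ae (ae_of_all _ fun X => ?_)
  simp only [gradDot_sq_left F (hβd X)]
  ring

/-- **Uniform bound on the second-order kinetic coefficient**:
`∫(β²Γ(F,F) + 2βFΓ(β,F) + F²Γ(β,β)) ≤ (B²+1)(∫|∇F|² + ∫F²|∇β|²)` for `|β| ≤ B`. [folklore] -/
theorem integral_cKin_le (hβ : ContDiff ℝ 1 β) (hF : ContDiff ℝ 1 F) {B : ℝ} (hB : ∀ X, |β X| ≤ B) :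
    ∫ X in cellN N L,
        (β X ^ 2 * gradDot F F X + 2 * (β X * F X * gradDot β F X) + F X ^ 2 * gradDot β β X) ≤
      (B ^ 2 + 1) * ((∫ X in cellN N L, gradDot F F X) + ∫ X in cellN N L, F X ^ 2 * gradDot β β X) := by
  have hβc := hβ.continuous
  have hFc := hF.continuous
  have hFF := continuous_gradDot hF hF
  have hβF := continuous_gradDot hβ hF
  have hββ := continuous_gradDot hβ hβ
  have i0 : IntegrableOn (fun X => gradDot F F X) (cellN N L) := integrableOn_cellN hFF L
  have i2 : IntegrableOn (fun X => β X ^ 2 * gradDot F F X + 2 * (β X * F X * gradDot β F X) +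
      F X ^ 2 * gradDot β β X) (cellN N L) :=
    integrableOn_cellN ((((hβc.pow 2).mul hFF).add (continuous_const.mul
      (((hβc.mul hFc).mul hβF)))).add ((hFc.pow 2).mul hββ)) L
  have i3 : IntegrableOn (fun X => F X ^ 2 * gradDot β β X) (cellN N L) :=
    integrableOn_cellN ((hFc.pow 2).mul hββ) L
  rw [← integral_add i0 i3, ← integral_const_mul]
  exact setIntegral_mono_on i2 ((i0.add i3).const_mul _) (measurableSet_cellN N L)
    fun X _ => cKin_integrand_le hB X

/-- `|∫_cell F² w| ≤ M² B vol(cell)` for `|F| ≤ M`, `|w| ≤ B`. [folklore] -/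
theorem abs_integral_sq_mul_le {w : Config N → ℝ} {M B : ℝ} (hM : ∀ X, |F X| ≤ M)
    (hB : ∀ X, |w X| ≤ B) :
    |∫ X in cellN N L, F X ^ 2 * w X| ≤ M ^ 2 * B * (volume (cellN N L)).toReal :=
  abs_setIntegral_cellN_le (abs_mul_le_forall (abs_sq_le_forall hM) hB)

end Integrated

end Summit.AtomisticToContinuum.BoseEinsteinCondensation.Theorems.CorrectorClosure.HealingScaleKacInsertion.ResponseDictionary

end
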